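import Summits.QuantumFields.YangMills.Theorems.BalabanLadderIRColdPressurePincer
import Summits.QuantumFields.YangMills.Theorems.DoublingDefectRecursionToGapColdDefect
import Summits.QuantumFields.YangMills.Theorems.BalabanLadderIRColdDoublingRecursionSC
import HarnessLib

/-!
# Line `doubling-bridge` on crux `BalabanLadder.IR` (stmt-QuantumFields-19354, rung R2c)

**REV 2 (2026-08-28, ideator ym-ir-idea-6 g2): stub R DISCHARGED by the tree theorem `AspectBootstrap.coldDoublingRecursionSC_holds`
(p596893; published by `crux write` only — NOT re-registered, director RULING g9-№1 (4)/(5)).  Open stubs = {`stub_coldExit` (E, at one ε₀ =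
1/(16·squaringConst)), `stub_afToColdPressure` (X), `stub_irnsc` (N)}.  YM gap NOT proved; IR not closed.**

Cell ym-ir, seat ym-ir-idea-6 g0 (lens: finite-size-scaling typed conjectures).  Slot `Cruxes/IR/Lines/doubling-bridge.lean`
— an ALTERNATIVE line; the skeleton of record stays `Cruxes/IR/Lines/af_pincer_Uc_sharp.lean`.

HONEST FRAMING.  The Yang–Mills mass gap (Clay) is NOT proved by anything here.  R4 (`BalabanUVStability4`) closes only
the conditional finite-𝕋⁴ rung `BalabanLadder.UV`.  This file is kernel bookkeeping of a CONDITIONAL reduction of ONE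
binder (`IR`) of the ladder: it shows that the two finite-size-scaling cruxes of the DORMANT route `DoublingDefect`
(stmt-QuantumFields-17753 `OneTorusExit`, stmt-QuantumFields-17754 `DoublingRecursion`), re-typed in the COLD purity
currency that the route's own landed glue `DoublingDefect.recursionToGap_of_coldDefect` actually consumes, together
with the cold-pressure pincer's open asymptotic-freedom stub `ColdPressurePincer.AFToColdPressure` (BY NAME) and the
residual of record `ColdPressurePincer.IRnsc` (BY NAME), imply `Summit.QuantumFields.YangMills.Theses.BalabanLadder.IR`
BY NAME.  The seam (exit ∧ recursion ⇒ per-β cold pressure) is PROVED here; sorries live ONLY in the four `stub_*`.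
0 legs discharged.

THE FINITE-SIZE-SCALING CONTENT (observable-free, periodic partition functions only).  With
`δᶜ_β(L) := 1 − Z_β(L³ × 2⌊L/4⌋) / Z_β(L³ × ⌊L/4⌋)²` (the COLD period-doubling / purity defect of the spatial torus `L³`
read at temperatures `4/L` against `2/L`; `= 1 − tr 𝒯^{2t}/(tr 𝒯^t)² ∈ [0,1)`, small iff one state dominates):
* **E** `ColdExitSC` — for simply-connected simple `G`: for every tolerance `ε > 0`, eventually in `β`, pure cold tori
  (`δᶜ_β(L) ≤ ε`) exist at arbitrarily large `L`.  ONE-SCALE statement («the theory exits the femto regime at every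
  weak coupling»); per `(β, L)` a single partition-function inequality, MC-checkable; false for `U(1)₄` (photon gas,
  Stefan–Boltzmann: `δᶜ(L) → 1 − e^{−(π²/45)(2·4³−2³)} ≈ 1 − e^{−26}` for every `L`, see the card) and for `π₁(G) ≠ 1` (`|π₁|³` light 't Hooft magnetic-flux vacua on `T³`: `δᶜ → 1 − |π₁|^{-3}`),
  hence the SC restriction and the residual.
* **R** `ColdDoublingRecursionSC` — for simply-connected simple `G`: `δᶜ_β(L') ≤ C · δᶜ_β(L)²` for `L' ∈ [2L, 4L]`,
  `L ≥ L₀`, `β ≥ β₀`, ONE constant `C`.  The SCALE-TRANSFER statement at FIXED coupling (Knabe-type finite-size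
  bootstrap with a model-dependent threshold `1/(16C)`, census B15/C22): THIS is where the infinite-volume content of
  `IR` lives.
* **X** `AFToColdPressure` (tree, open, shared with line `cold-pressure-pincer`) — asymptotic freedom below the cold-
  pressure length pins the unit: `a β · ξ⋆(β) < T` (`ColdPressurePincer.cp_pinned`, proved in tree).
* **N** `IRnsc` (tree, open residual of record) — the crux on the non-simply-connected family.
Composition (all real proofs): E ∧ R ⇒ (seam `coldPressureAt_of_exit_recursion`, this file: iterate R from an exit
scale `L⋆(β)` — `DoublingDefect.defect_decay_of_recursion` —, read the defect spectrally —
`traceExcess_le_of_coldDefect_le`, `traceExcess_le_exp_of_le` — to get `ColdPressureAt r.ρ β L⋆(β)`) ⇒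
`ColdPressureOnsetSC` ⇒ (`ColdPressurePincer.IR_of_cp_repaired` with X and N) ⇒ `IR`.

WHAT IS NEW (honest grade: BRIDGE / new wiring, no new mechanism).  (i) The dormant route `DoublingDefect` targets the
per-β lattice gap and then `YangMills` through its own existence leg; nobody had wired its two cruxes to the LIVE leaf
`BalabanLadder.IR` (gap IN UNITS under `LowerBounds`).  The wiring needs exactly one extra input, the AF pin X, and
shows the three open IR lines (af-pincer, cold-pressure pincer, this) share the UV-side stub while differing on the
IR side: mixing onset ∕ cold-pressure onset ∕ (exit + dyadic contraction).  (ii) The items 17753/17754 are typed with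
the aspect-(1,2) defect `1 − Z(L³×2L)/Z(L³×L)²`, for which the route's glue is NOT available (its landed repair uses
the cold defect); E and R here are the cold re-typings, verbatim the hypotheses `hE`, `hR` of
`recursionToGap_of_coldDefect` restricted to nothing — so a proof of E ∧ R closes BOTH this line's IR side and the
dormant route's `RecursionToGap` chain.  (iii) Versus `Lines/ym_ir7_volume_monotone_gap` (FV + MONO, filed 2026-08-27):
same two-storey architecture (one scale + scale transfer at fixed β) but a CONTRACTING transfer (`δ ↦ C δ²`, dyadic)
instead of a monotone one (`rate ↦ θ·rate`), in purity instead of cold-pressure currency, with the unit pinned by X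
instead of by `LowerBounds` inside FV; the contraction is what makes the output rate `4/L⋆(β)` come from the exit scale
alone.

CHEAPEST FALSIFIER / INSTRUMENT (ask ym-ir-eng-1/3): SU(2) Wilson action, thermodynamic integration of
`log Z_β(L³×t)` for `t ∈ {⌊L/4⌋, 2⌊L/4⌋}`, `L ∈ {8, 12, 16, 24}`, `β ∈ {2.3, 2.4, 2.5, 2.6}`: (a) is there an exit
`δᶜ ≤ 1/32` at `L ≈ 2–3 ξ_glueball`? (b) the recursion constant `C(β) := max_L δᶜ(2L)/δᶜ(L)²` — bounded in β?  A `C(β)`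
growing without bound as β grows at fixed `L/ξ` kills R as typed (β-uniform `C`).  Strong-coupling rung: E and the
upper half of R follow from `Balaban1983to89.Missing.coldFreeEnergyBound_of_strongCoupling` (tree) for
`β ≤ strongCouplingRadius`; the lower bound on `δᶜ(L)` that R needs there (`δᶜ(L) ≳ L³ e^{−m L/4}`) is a one-glueball
lower bound not in tree.
RUNGS (rev 2, critic ym-ir-crit-1 price (d) «rung not typed», §6): on the strong-coupling window `0 ≤ β ≤ strongCouplingRadius ρ`
— PROVED `coldExitSC_strongCoupling` (E's body, group-blind, uniformly in `β` on the window, from the tree's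
`traceExcess_le_of_strongCoupling` and the bookkeeping `δᶜ ≤ 2x` = `one_sub_ratio_le_two_mul_traceExcess`), TYPED-OPEN
`ColdDoublingRecursionStrongCoupling` (R's instance on the window; its upper half is the same tree bound, the matching
one-particle LOWER bound on `δᶜ` is not in tree).  `floorToPurity_conclusion_strongCoupling` serves the sister line
`floor_handshake`.
SPECTRAL CURRENCY (rev 3, §7): PROVED `2x/(1+x)² ≤ δᶜ` (`one_sub_ratio_ge_of_traceExcess`; with `δᶜ ≤ 2x` the dictionary is
two-sided) and PROVED `coldDoublingRecursionSC_of_spectral : SpectralDiagonalContractionSC → ColdDoublingRecursionSC` and its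
converse `spectral_of_coldDoublingRecursionSC` — R is EQUIVALENT (up to constants) to its transfer-matrix spectral form (the
excited thermal tower squares under simultaneous space-and-time doubling past the exit).
-/

set_option autoImplicit false

noncomputable section

open Filter Topology MeasureTheory
open scoped SchwartzMap
open Literature.MathematicalPhysics.QuantumFieldTheory Literature.MathematicalPhysics.QuantumLattice
open Summit.QuantumFields.YangMills.Cruxes.OSLegsFromFemtoAndGap.DlrCollarTransfer (GapInUnits LowerBounds Q2)
open Literature.MathematicalPhysics.QuantumFieldTheory.Balaban1983to89.Sufficient (ColdPressureBound)
open Summit.QuantumFields.YangMills.Theorems.DoublingDefect (coldDefect_nonneg traceExcess_le_of_coldDefect_le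
  traceExcess_le_exp_of_le defect_decay_of_recursion)
open Summit.QuantumFields.YangMills.Cruxes.IR.ColdPressurePincer

namespace Summit.QuantumFields.YangMills.Cruxes.IR.DoublingBridge

/-! ## §1 The currency: the cold period-doubling (purity) defect -/

section Defs

variable {G : Type} [Group G] [TopologicalSpace G] [IsTopologicalGroup G] [CompactSpace G]
  [MeasurableSpace G] [BorelSpace G]

/-- The **cold period-doubling defect** `δᶜ_β(L) = 1 − Z_β(L,L,L,2⌊L/4⌋) / Z_β(L,L,L,⌊L/4⌋)²` — VERBATIM the defect
of `DoublingDefect.recursionToGap_of_coldDefect` (there inlined; `wilsonFinTorusPartition` = the inline Haar integral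
by `rfl`).  Observable-free; `∈ [0,1)` for `L ≥ 8`, `β ≥ 0` (`coldDefect_nonneg`). -/
def coldDefect {N : ℕ} (ρ : G →* Matrix (Fin N) (Fin N) ℂ) (β : ℝ) (L : ℕ) : ℝ :=
  1 - wilsonFinTorusPartition ρ β L L L (2 * (L / 4)) / wilsonFinTorusPartition ρ β L L L (L / 4) ^ 2

end Defs

/-! ## §2 The stub statements -/

/-- **E — `ColdExitSC` (crux, rank 3): pure cold tori exist at every weak coupling (ONE scale per β).**
For compact simple SIMPLY-CONNECTED `G` and every lattice representation `r`: for every `ε > 0` there is `β₁` such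
that for all `β ≥ β₁` and every `L₀` some `L ≥ L₀` has `δᶜ_β(L) ≤ ε`.  (Route `DoublingDefect`'s `OneTorusExit`,
stmt-QuantumFields-17753, in the cold currency = hypothesis `hE` of `recursionToGap_of_coldDefect`.)
Why it might fail: it is the weak-coupling confinement scale seen at ONE size: vacuum dominance of the cold torus needs
`L ≳ ξ(β) log(L³/ε) ~ e^{cβ}`, beyond every expansion; `U(1)₄` fails it (photon gas), `SO(3)` fails it (light flux),
so any proof must use both non-abelianness and `π₁ = 1`.
Sources: Luscher1977; PrivmanFisher1983; Luscher1986; BorgsKotecky1990; route file `Theses/DoublingDefect.lean`;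
`Literature.Barriers.QuantumFields.AbelianDeconfinementD4`. -/
def ColdExitSC : Prop :=
  ∀ (G : Type) [Group G] [TopologicalSpace G] [IsTopologicalGroup G] [CompactSpace G],
    IsCompactSimpleLieGroup G → SimplyConnectedSpace G →
    letI : MeasurableSpace G := borel G
    haveI : BorelSpace G := ⟨rfl⟩
    ∀ r : LatticeRep G, ∀ ε : ℝ, 0 < ε → ∃ β₁ : ℝ, ∀ β : ℝ, β₁ ≤ β →
      ∀ L₀ : ℕ, ∃ L : ℕ, L₀ ≤ L ∧ coldDefect r.ρ β L ≤ ε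

/-- **R — `ColdDoublingRecursionSC` (crux, rank 2 — the load-bearing scale transfer): the cold defect CONTRACTS
under dyadic doubling at fixed coupling.**  For compact simple simply-connected `G` and every `r` there are `C > 0`,
`β₀`, `L₀` with `δᶜ_β(L') ≤ C · δᶜ_β(L)²` for all `β ≥ β₀`, `L ≥ L₀`, `L' ∈ [2L, 4L]`.  (Route `DoublingDefect`'s
`DoublingRecursion`, stmt-QuantumFields-17754, in the cold currency = hypothesis `hR` of `recursionToGap_of_coldDefect`.)
A Knabe-type finite-size bootstrap for Lüscher's transfer matrix with the MODEL-DEPENDENT threshold `1/(16C)`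
(census B15: asserted nowhere for lattice gauge theory; C22: no universal threshold can exist — respected).
Why it might fail: light states fitting only the bigger box (a torus gap dropping under spatial doubling faster than
`O(log L / L)` while `δᶜ(L)` is already small) break the plain squaring; `C` uniform in `β ≥ β₀` may fail through the
`(m/2πt)^{3/2}`-type multiplicity prefactors if they are not scale-covariant along `β → ∞`.
Sources: Knabe1988; GossetMozgunov2016; Luscher1977; OsterwalderSeilerAnnPhys1978; Borgs1993; `pub/ym-ir/REDUCTION-CENSUS.md` B15. -/
def ColdDoublingRecursionSC : Prop :=
  ∀ (G : Type) [Group G] [TopologicalSpace G] [IsTopologicalGroup G] [CompactSpace G],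
    IsCompactSimpleLieGroup G → SimplyConnectedSpace G →
    letI : MeasurableSpace G := borel G
    haveI : BorelSpace G := ⟨rfl⟩
    ∀ r : LatticeRep G, ∃ C β₀ : ℝ, ∃ L₀ : ℕ, 0 < C ∧ ∀ β : ℝ, β₀ ≤ β → ∀ L : ℕ, L₀ ≤ L →
      ∀ L' : ℕ, 2 * L ≤ L' → L' ≤ 4 * L → coldDefect r.ρ β L' ≤ C * coldDefect r.ρ β L ^ 2

/-! ## §3 Registered stubs (sorries live ONLY here) -/

/-- **R DISCHARGED (rev 2, 2026-08-28) — no longer a stub.**  `ColdDoublingRecursionSC` is PROVED in the tree: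
`AspectBootstrap.coldDoublingRecursionSC_holds` (`Theorems/BalabanLadderIRColdDoublingRecursionSC.lean`, p596893, lead
prover ym-ir-line-ab-p1; line `aspect-bootstrap` of ideator ym-ir-idea-6 g2, critics crit-1/crit-2 PASS; `C = 2·432²·e^{432}`,
`β₀ = 0`, `L₀ = 8`, valid for EVERY compact `G` at every `β ≥ 0` — R carries no Yang–Mills difficulty).  This file's
`ColdDoublingRecursionSC`/`coldDefect` and `ColdPurityBridge`'s are text-identical copies, so the tree theorem closes this decl
by definitional unfolding.  HONEST: this discharges R only; H (resp. E, X) and N stay open; the YM gap is NOT proved. -/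
theorem coldDoublingRecursion_discharged : ColdDoublingRecursionSC :=
  Summit.QuantumFields.YangMills.Cruxes.IR.AspectBootstrap.coldDoublingRecursionSC_holds

/-- stub **E** (crux, rank 3): `ColdExitSC`. OPEN (route `DoublingDefect`, item 17753, cold currency). -/
theorem stub_coldExit : ColdExitSC := by
  sorry

/-- stub **X** (crux, by name): the cold-pressure pincer's asymptotic-freedom pin `ColdPressurePincer.AFToColdPressure`.
OPEN, shared with line `cold-pressure-pincer` (`ym19354-5`); same statement, not re-typed. -/
theorem stub_afToColdPressure : AFToColdPressure := by
  sorry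

/-- stub **N** (RESIDUAL of record, by name): `ColdPressurePincer.IRnsc`, the crux on the non-simply-connected family;
carried open exactly as in `IR_of_cp_repaired` and `af_pincer_Uc_sharp.stub_irNSC`. No claim. -/
theorem stub_irnsc : IRnsc := by
  sorry

/-! ## §4 The seam, PROVED: exit ∧ recursion at one β ⇒ cold pressure at that β (no sorry below this line) -/

section Seam

variable {G : Type} [Group G] [TopologicalSpace G] [IsTopologicalGroup G] [CompactSpace G]
  [MeasurableSpace G] [BorelSpace G]

/-- **Seam (PROVED; the first two thirds of `DoublingDefect.recursionToGap_of_coldDefect`, group-blind, one β).**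
If at coupling `β ≥ 0` the cold defect obeys the doubling recursion with constant `C` beyond `L₀` and exits below
`1/(16·max C 2)` at some scale `L⋆ ≥ max L₀ 8`, then cold pressure holds at `β` with length `L⋆`:
iterate (`defect_decay_of_recursion`: `δᶜ_β(L) ≤ C'^{-1} e^{−(L+1)/L⋆}` for `L ≥ 2L⋆`), read spectrally at
`P = 2S+1 ≥ 2L⋆` (`traceExcess_le_of_coldDefect_le`: `x_{⌊P/4⌋} ≤ 2δᶜ ≤ e^{−(4/L⋆)⌊P/4⌋}`), propagate to every cold
extent (`traceExcess_le_exp_of_le`), and weaken the rate `4/L⋆` to `1/L⋆`. -/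
theorem coldPressureAt_of_exit_recursion (r : LatticeRep G) {β : ℝ} (hβ0 : 0 ≤ β) {C : ℝ} (hC : 0 < C)
    {L₀ : ℕ}
    (hrec : ∀ L : ℕ, L₀ ≤ L → ∀ L' : ℕ, 2 * L ≤ L' → L' ≤ 4 * L →
      coldDefect r.ρ β L' ≤ C * coldDefect r.ρ β L ^ 2)
    {Ls : ℕ} (hLs : max L₀ 8 ≤ Ls) (hex : coldDefect r.ρ β Ls ≤ 1 / (16 * max C 2)) :
    ColdPressureAt r.ρ β Ls := by
  haveI : SecondCountableTopology G :=
    (r.continuous.isClosedEmbedding r.injective).isEmbedding.secondCountableTopology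
  -- WLOG `C ≥ 2`
  set C' : ℝ := max C 2 with hC'def
  have hC' : 0 < C' := lt_of_lt_of_le hC (le_max_left _ _)
  have hC'2 : 2 ≤ C' := le_max_right _ _
  have hrec' : ∀ L : ℕ, L₀ ≤ L → ∀ L' : ℕ, 2 * L ≤ L' → L' ≤ 4 * L →
      coldDefect r.ρ β L' ≤ C' * coldDefect r.ρ β L ^ 2 := fun L hL L' h2 h4 =>
    (hrec L hL L' h2 h4).trans (mul_le_mul_of_nonneg_right (le_max_left _ _) (sq_nonneg _))
  -- the cold defect is non-negative at every scale `L ≥ 8`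
  have hnn : ∀ L : ℕ, 8 ≤ L → 0 ≤ coldDefect r.ρ β L := fun L hL => by
    haveI : NeZero L := ⟨by omega⟩
    exact coldDefect_nonneg r.continuous r.mem_unitary hβ0 L (L / 4) (by omega)
  have hLs8 : 8 ≤ Ls := le_trans (le_max_right _ _) hLs
  have hdec := defect_decay_of_recursion (δ := coldDefect r.ρ β) (L₀ := max L₀ 8) (Ls := Ls) hC'
    (fun L hL L' h2 h4 => hrec' L (le_trans (le_max_left _ _) hL) L' h2 h4)
    (fun L hL => hnn L (le_trans (le_max_right _ _) hL)) hLs (by omega) hex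
  have hLsR : (0 : ℝ) < Ls := by exact_mod_cast (by omega : 0 < Ls)
  -- cold pressure with `C₀ = 1`, `S₁ = L⋆`, rate `1 / L⋆`
  refine ⟨1, Ls, zero_le_one, fun S hS m hm => ?_⟩
  -- `P = 2S+1 ≥ 2 L⋆`, `t₀ = ⌊P/4⌋ = m₀ + 2 ≥ 4`
  obtain ⟨m₀, hm₀⟩ : ∃ m₀ : ℕ, (2 * S + 1) / 4 = m₀ + 2 := ⟨(2 * S + 1) / 4 - 2, by omega⟩
  have hm₀m : m₀ ≤ m := by omega
  have hP : 2 * Ls ≤ 2 * S + 1 := by omega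
  -- `δᶜ_β(P) ≤ C'⁻¹ e^{−(P+1)/L⋆} ≤ 1/2`
  have hδP := hdec (2 * S + 1) hP
  have hexp1 : Real.exp (-((((2 * S + 1 : ℕ) : ℝ) + 1) / Ls)) ≤ 1 :=
    Real.exp_le_one_iff.2 (by
      have : (0 : ℝ) ≤ (((2 * S + 1 : ℕ) : ℝ) + 1) / Ls := by positivity
      linarith)
  have hCinv : C'⁻¹ ≤ 1 / 2 := by rw [inv_eq_one_div]; exact one_div_le_one_div_of_le two_pos hC'2
  have hCinv0 : 0 ≤ C'⁻¹ := inv_nonneg.2 hC'.le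
  have hδhalf : coldDefect r.ρ β (2 * S + 1) ≤ 1 / 2 :=
    hδP.trans ((mul_le_mul hCinv hexp1 (Real.exp_pos _).le (by norm_num)).trans (by norm_num))
  -- `x_{t₀} ≤ 2 δᶜ_β(P)`
  have hδP' : 1 - wilsonFinTorusPartition r.ρ β (2 * S + 1) (2 * S + 1) (2 * S + 1) (2 * (m₀ + 2)) /
      wilsonFinTorusPartition r.ρ β (2 * S + 1) (2 * S + 1) (2 * S + 1) (m₀ + 2) ^ 2 ≤
        coldDefect r.ρ β (2 * S + 1) := by
    unfold coldDefect
    rw [hm₀]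
  have hx₀ := traceExcess_le_of_coldDefect_le r.continuous r.mem_unitary hβ0 (2 * S + 1) m₀ hδhalf hδP'
  -- `2 δᶜ_β(P) ≤ e^{−(P+1)/L⋆} ≤ e^{−(4/L⋆) t₀}`
  have h2δ : 2 * coldDefect r.ρ β (2 * S + 1) ≤ Real.exp (-(4 / Ls * ((m₀ + 2 : ℕ) : ℝ))) := by
    have h1 : 2 * coldDefect r.ρ β (2 * S + 1) ≤ Real.exp (-((((2 * S + 1 : ℕ) : ℝ) + 1) / Ls)) := by
      have h := mul_le_mul_of_nonneg_left hδP zero_le_two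
      refine h.trans ?_
      rw [← mul_assoc]
      have h2C : 2 * C'⁻¹ ≤ 1 := by linarith
      exact (mul_le_of_le_one_left (Real.exp_pos _).le h2C)
    refine h1.trans (Real.exp_le_exp.2 ?_)
    have ht₀ : 4 * ((m₀ + 2 : ℕ) : ℝ) ≤ ((2 * S + 1 : ℕ) : ℝ) + 1 := by
      have h : 4 * (m₀ + 2) ≤ 2 * S + 1 + 1 := by omega
      exact_mod_cast h
    rw [neg_le_neg_iff, div_mul_eq_mul_div, div_le_div_iff_of_pos_right hLsR]
    exact ht₀
  have hx₀' : traceExcess r.ρ β (2 * S + 1) (m₀ + 2) ≤ Real.exp (-(4 / Ls * ((m₀ + 2 : ℕ) : ℝ))) :=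
    hx₀.trans h2δ
  -- propagate to the extent `m + 2 ≥ t₀`
  have hxm := traceExcess_le_exp_of_le r.continuous r.mem_unitary hβ0 (2 * S + 1) hm₀m hx₀'
  refine hxm.trans ?_
  -- weaken the rate `4/L⋆ ↦ 1/L⋆` and the constant `1 ↦ 1 · (2S+1)³`
  have hrate : Real.exp (-(4 / Ls * ((m + 2 : ℕ) : ℝ))) ≤
      Real.exp (-(1 / (Ls : ℝ) * ((m + 2 : ℕ) : ℝ))) := by
    refine Real.exp_le_exp.2 ?_
    rw [neg_le_neg_iff]
    have hm2 : (0 : ℝ) ≤ ((m + 2 : ℕ) : ℝ) := by positivity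
    have h14 : 1 / (Ls : ℝ) ≤ 4 / Ls := by
      rw [div_le_div_iff_of_pos_right hLsR]; norm_num
    exact mul_le_mul_of_nonneg_right h14 hm2
  refine hrate.trans ?_
  have hV : (1 : ℝ) ≤ 1 * ((2 * S + 1 : ℕ) : ℝ) ^ 3 := by
    rw [one_mul]
    exact one_le_pow₀ (by exact_mod_cast (by omega : 1 ≤ 2 * S + 1))
  exact le_mul_of_one_le_left (Real.exp_pos _).le hV

end Seam

/-- **E ∧ R ⇒ the pincer's stub `ColdPressureOnsetSC`** (REAL proof): per `(G, r)`, `R` gives `(C, β₀, L₀)`; `E` at the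
tolerance `1/(16·max C 2)` gives `β₁`; for `β ≥ max(β₀, β₁, 0)` an exit scale `L⋆ ≥ max(L₀, 8)` exists and the seam
yields `ColdPressureAt r.ρ β L⋆` with `L⋆ ≥ 8 ≥ 1`. -/
theorem coldPressureOnsetSC_of_bridge (hR : ColdDoublingRecursionSC) (hE : ColdExitSC) : ColdPressureOnsetSC := by
  intro G _ _ _ _ hG hsc
  letI : MeasurableSpace G := borel G
  haveI : BorelSpace G := ⟨rfl⟩
  intro r
  obtain ⟨C, β₀, L₀, hC, hrec⟩ := hR G hG hsc r
  have hC' : 0 < max C 2 := lt_of_lt_of_le hC (le_max_left _ _)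
  obtain ⟨β₁, hβ₁⟩ := hE G hG hsc r (1 / (16 * max C 2)) (by positivity)
  refine ⟨max β₀ (max β₁ 0), fun β hβ => ?_⟩
  have hββ₀ : β₀ ≤ β := le_trans (le_max_left _ _) hβ
  have hββ₁ : β₁ ≤ β := le_trans ((le_max_left _ _).trans (le_max_right _ _)) hβ
  have hβ0 : 0 ≤ β := le_trans ((le_max_right _ _).trans (le_max_right _ _)) hβ
  obtain ⟨Ls, hLs, hex⟩ := hβ₁ β hββ₁ (max L₀ 8)
  exact ⟨Ls, by omega, coldPressureAt_of_exit_recursion r hβ0 hC (hrec β hββ₀) hLs hex⟩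

/-- **The line concludes the crux `IR` BY NAME** from E, R (this line's IR side), X (the pincer's AF pin, by name) and the
residual N (by name): `ColdPressurePincer.IR_of_cp_repaired` over `coldPressureOnsetSC_of_bridge`. Kernel-checked, no sorry. -/
theorem IR_of_bridge (hR : ColdDoublingRecursionSC) (hE : ColdExitSC) (hX : AFToColdPressure) (hN : IRnsc) :
    Summit.QuantumFields.YangMills.Theses.BalabanLadder.IR :=
  IR_of_cp_repaired (coldPressureOnsetSC_of_bridge hR hE) hX hN

/-- The registered composition over the stubs (rev 2: three open — E, X, N — and R discharged). -/
theorem IR_of_stubs : Summit.QuantumFields.YangMills.Theses.BalabanLadder.IR :=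
  IR_of_bridge coldDoublingRecursion_discharged stub_coldExit stub_afToColdPressure stub_irnsc

/-! ## §6 Rungs on the strong-coupling window `0 ≤ β ≤ r_ρ` (critic ym-ir-crit-1, price (d) «rung not typed»)

Group-blind (every compact `G`, every lattice representation): the strong-coupling cluster expansion of the tree
(`Balaban1983to89.Missing.traceExcess_le_of_strongCoupling`, PROVED: `x_{T+2}(N) ≤ exp(12N³(T+2)e^{−⌊(T+2)/2⌋}) − 1` for
`0 ≤ β ≤ strongCouplingRadius ρ`) bounds the thermal trace excess, and `δᶜ ≤ 2x` (below) turns it into purity.  So: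
E's body holds on the window (PROVED, `coldExitSC_strongCoupling`, even uniformly in `β`); H's CONCLUSION holds there
WITHOUT its floor hypothesis (PROVED, `floorToPurity_conclusion_strongCoupling` — honest reading: H is conclusion-free at
strong coupling, all of its content sits at weak coupling); R's instance on the window is TYPED and left OPEN
(`ColdDoublingRecursionStrongCoupling`): its upper half is the same tree bound, the matching LOWER bound
`δᶜ_β(L) ≳ L³e^{−m(β)L/4}` (one-particle dominance of the thermal trace) is not in tree. -/

section Rungs

variable {G : Type} [Group G] [TopologicalSpace G] [IsTopologicalGroup G] [CompactSpace G]
  [MeasurableSpace G] [BorelSpace G]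

open Literature.MathematicalPhysics.QuantumFieldTheory.Balaban1983to89.Missing (strongCouplingRadius
  traceExcess_le_of_strongCoupling)
open Summit.QuantumFields.YangMills.Theorems.DoublingDefect (exists_ratios_hasSum_traceExcess)

/-- **Impurity is carried by the trace excess**: `1 − Z(N³×2t)/Z(N³×t)² ≤ 2·x_t(N)` for `t = m + 2`, `β ≥ 0`
(`Z(2t)/Z(t)² = T₂/T₁²` with `T₁ = 1 + x_t`, `T₂ = 1 + x_{2t} ≥ 1`, and `1 − 1/(1+x)² ≤ 2x`) — the converse bookkeeping
to `DoublingDefect.traceExcess_le_of_coldDefect_le`. -/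
theorem one_sub_ratio_le_two_mul_traceExcess (r : LatticeRep G) {β : ℝ} (hβ : 0 ≤ β) (N m : ℕ) [NeZero N] :
    1 - wilsonFinTorusPartition r.ρ β N N N (2 * (m + 2)) / wilsonFinTorusPartition r.ρ β N N N (m + 2) ^ 2 ≤
      2 * traceExcess r.ρ β N (m + 2) := by
  haveI : SecondCountableTopology G :=
    (r.continuous.isClosedEmbedding r.injective).isEmbedding.secondCountableTopology
  obtain ⟨ι, _, q, i₀, hq, hqi₀, hpos, hT, hx⟩ :=
    exists_ratios_hasSum_traceExcess r.continuous r.mem_unitary hβ N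
  set lp : ℝ := transferSpectralRadius r.ρ β N with hlp
  set W₁ : ℝ := wilsonFinTorusPartition r.ρ β N N N (m + 2) with hW₁
  set W₂ : ℝ := wilsonFinTorusPartition r.ρ β N N N (2 * (m + 2)) with hW₂
  have hW₁pos : 0 < W₁ := wilsonFinTorusPartition_pos r.continuous β N N N (m + 2)
  have hT₁ := hT m
  have hT₂ : HasSum (fun i => q i ^ (2 * m + 2 + 2)) (W₂ / lp ^ (2 * (m + 2))) := by
    have h := hT (2 * m + 2)
    rw [show 2 * m + 2 + 2 = 2 * (m + 2) from by ring] at h ⊢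
    exact h
  set T₁ : ℝ := W₁ / lp ^ (m + 2) with hT₁def
  set T₂ : ℝ := W₂ / lp ^ (2 * (m + 2)) with hT₂def
  have hT₂ge : 1 ≤ T₂ := by
    have h := le_hasSum hT₂ i₀ fun j _ => pow_nonneg (hq j).1 _
    simpa [hqi₀] using h
  have hT₁ge : 1 ≤ T₁ := by
    have h := le_hasSum hT₁ i₀ fun j _ => pow_nonneg (hq j).1 _
    simpa [hqi₀] using h
  have hxT : traceExcess r.ρ β N (m + 2) = T₁ - 1 := by
    have h := hx m
    have h' : HasSum (Function.update (fun i => q i ^ (m + 2)) i₀ 0) (0 - 1 + T₁) := by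
      have := hT₁.update i₀ 0
      simpa [hqi₀] using this
    have := h.unique h'
    linarith
  have hT₁pos : 0 < T₁ := lt_of_lt_of_le one_pos hT₁ge
  have hid : W₂ / W₁ ^ 2 = T₂ / T₁ ^ 2 := by
    have h1 : lp ^ (m + 2) ≠ 0 := pow_ne_zero _ hpos.ne'
    have h2 : W₁ ≠ 0 := hW₁pos.ne'
    rw [hT₂def, hT₁def]
    field_simp
    ring
  have h1 : 1 / T₁ ^ 2 ≤ W₂ / W₁ ^ 2 := by
    rw [hid]
    exact div_le_div_of_nonneg_right hT₂ge (sq_nonneg _)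
  have h2 : 1 - 2 * (T₁ - 1) ≤ 1 / T₁ ^ 2 := by
    rw [le_div_iff₀ (by positivity)]
    have hu : 0 ≤ T₁ - 1 := sub_nonneg.2 hT₁ge
    nlinarith [mul_nonneg hu hu, mul_nonneg (mul_nonneg hu hu) hu]
  rw [hxT]
  linarith

/-- **Cold defect on the strong-coupling window**, tori `L = 8k`, `k ≥ 1`: `δᶜ_β(8k) ≤ 2(exp(12288·k⁴·e^{−k}) − 1)` for
`0 ≤ β ≤ strongCouplingRadius ρ` — `traceExcess_le_of_strongCoupling` at `N = 8k`, `T + 2 = 2k = ⌊8k/4⌋`, `⌊2k/2⌋ = k`. -/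
theorem coldDefect_le_of_strongCoupling (r : LatticeRep G) {β : ℝ} (hβ0 : 0 ≤ β)
    (hβ : β ≤ strongCouplingRadius r.ρ) (k : ℕ) (hk : 1 ≤ k) :
    coldDefect r.ρ β (8 * k) ≤ 2 * (Real.exp (12288 * (k : ℝ) ^ 4 * Real.exp (-(k : ℝ))) - 1) := by
  haveI : SecondCountableTopology G :=
    (r.continuous.isClosedEmbedding r.injective).isEmbedding.secondCountableTopology
  haveI : NeZero (8 * k) := ⟨by omega⟩
  obtain ⟨m, hm⟩ : ∃ m : ℕ, 2 * k = m + 2 := ⟨2 * k - 2, by omega⟩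
  have hdiv : 8 * k / 4 = m + 2 := by omega
  have hfl : (m + 2) / 2 = k := by omega
  have hA := one_sub_ratio_le_two_mul_traceExcess r hβ0 (8 * k) m
  have hX := traceExcess_le_of_strongCoupling r.ρ r.continuous r.mem_unitary hβ0 hβ (8 * k) m
  rw [hfl] at hX
  have hcast : 12 * ((8 * k : ℕ) : ℝ) ^ 3 * ((m : ℝ) + 2) = 12288 * (k : ℝ) ^ 4 := by
    have h2 : (m : ℝ) + 2 = 2 * k := by
      have := congrArg (Nat.cast : ℕ → ℝ) hm
      push_cast at this
      linarith
    rw [h2]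
    push_cast
    ring
  rw [hcast] at hX
  unfold coldDefect
  rw [hdiv]
  linarith

/-- The strong-coupling majorant tends to zero: `2(exp(12288 k⁴ e^{−k}) − 1) → 0`. -/
theorem tendsto_strongCouplingMajorant :
    Tendsto (fun k : ℕ => 2 * (Real.exp (12288 * (k : ℝ) ^ 4 * Real.exp (-(k : ℝ))) - 1)) atTop (𝓝 0) := by
  have h1 : Tendsto (fun x : ℝ => x ^ 4 * Real.exp (-x)) atTop (𝓝 0) :=
    Real.tendsto_pow_mul_exp_neg_atTop_nhds_zero 4
  have h2 : Tendsto (fun k : ℕ => 12288 * ((k : ℝ) ^ 4 * Real.exp (-(k : ℝ)))) atTop (𝓝 (12288 * 0)) :=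
    (h1.comp tendsto_natCast_atTop_atTop).const_mul 12288
  have h3 : Tendsto (fun k : ℕ => 2 * (Real.exp (12288 * ((k : ℝ) ^ 4 * Real.exp (-(k : ℝ)))) - 1)) atTop
      (𝓝 (2 * (Real.exp (12288 * 0) - 1))) :=
    (((Real.continuous_exp.tendsto _).comp h2).sub_const 1).const_mul 2
  simp only [mul_zero, Real.exp_zero, sub_self] at h3
  refine Tendsto.congr (fun k => ?_) h3
  simp only [mul_assoc]

/-- **Uniform cold exit on the strong-coupling window (PROVED)**: for every `ε > 0` one `k₁ ≥ 1` with `δᶜ_β(8k) ≤ ε`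
for all `k ≥ k₁` and ALL `0 ≤ β ≤ strongCouplingRadius ρ`. -/
theorem coldExit_uniform_of_strongCoupling (r : LatticeRep G) {ε : ℝ} (hε : 0 < ε) :
    ∃ k₁ : ℕ, 1 ≤ k₁ ∧ ∀ β : ℝ, 0 ≤ β → β ≤ strongCouplingRadius r.ρ →
      ∀ k : ℕ, k₁ ≤ k → coldDefect r.ρ β (8 * k) ≤ ε := by
  obtain ⟨k₀, hk₀⟩ := eventually_atTop.1 ((tendsto_order.1 tendsto_strongCouplingMajorant).2 ε hε)
  refine ⟨max k₀ 1, le_max_right _ _, fun β hβ0 hβ k hk => ?_⟩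
  have h1 := coldDefect_le_of_strongCoupling r hβ0 hβ k (le_trans (le_max_right _ _) hk)
  have h2 := hk₀ k (le_trans (le_max_left _ _) hk)
  linarith [h1, h2.le]

/-- **RUNG for E (PROVED): the body of `ColdExitSC` on the strong-coupling window** — for every compact `G` and every
lattice representation (no simplicity, no `π₁ = 1`: strong coupling is group-blind), `0 ≤ β ≤ strongCouplingRadius r.ρ`,
`ε > 0`, `L₀`: some `L ≥ L₀` has `δᶜ_β(L) ≤ ε`.  E itself asks this for all LARGE `β` on simply-connected simple `G`. -/
theorem coldExitSC_strongCoupling (r : LatticeRep G) {β : ℝ} (hβ0 : 0 ≤ β) (hβ : β ≤ strongCouplingRadius r.ρ)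
    {ε : ℝ} (hε : 0 < ε) (L₀ : ℕ) : ∃ L : ℕ, L₀ ≤ L ∧ coldDefect r.ρ β L ≤ ε := by
  obtain ⟨k₁, hk₁, h⟩ := coldExit_uniform_of_strongCoupling r hε
  exact ⟨8 * max k₁ L₀, by omega, h β hβ0 hβ _ (le_max_left _ _)⟩

/-- **RUNG for H (PROVED — and honestly CONCLUSION-ONLY): on the strong-coupling window the conclusion of
`FloorToPuritySC` holds WITHOUT the floor hypothesis**, with `s₀ = 1` and window factor `k = 16k₁(ε₀)`: for
`0 ≤ β ≤ strongCouplingRadius r.ρ` and `0 < s ≤ 1` some `L' ∈ [1/s, k/s]`, `L' ≥ 8`, is `ε₀`-pure.  (So H has NO content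
at strong coupling; its content — the handshake between the floor scale and the purity scale — is at weak coupling.) -/
theorem floorToPurity_conclusion_strongCoupling (r : LatticeRep G) {ε₀ : ℝ} (hε₀ : 0 < ε₀) :
    ∃ k : ℝ, ∀ β : ℝ, 0 ≤ β → β ≤ strongCouplingRadius r.ρ → ∀ s : ℝ, 0 < s → s ≤ 1 →
      ∃ L' : ℕ, 8 ≤ L' ∧ 1 / s ≤ (L' : ℝ) ∧ (L' : ℝ) ≤ k / s ∧ coldDefect r.ρ β L' ≤ ε₀ := by
  obtain ⟨k₁, hk₁, h⟩ := coldExit_uniform_of_strongCoupling r hε₀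
  refine ⟨16 * k₁, fun β hβ0 hβ s hs hs1 => ?_⟩
  set j : ℕ := ⌈1 / s⌉₊ with hj
  have hj1 : 1 / s ≤ (j : ℝ) := Nat.le_ceil _
  have hs' : 1 ≤ 1 / s := by rw [le_div_iff₀ hs]; linarith
  have hjpos : 1 ≤ j := by
    have : (1 : ℝ) ≤ j := hs'.trans hj1
    exact_mod_cast this
  have hjle : (j : ℝ) ≤ 1 / s + 1 := (Nat.ceil_lt_add_one (by positivity)).le
  have hkj : 1 ≤ k₁ * j := by simpa using Nat.mul_le_mul hk₁ hjpos
  have hk₁' : (1 : ℝ) ≤ k₁ := by exact_mod_cast hk₁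
  have hj0 : (0 : ℝ) ≤ j := by positivity
  have hjs : (j : ℝ) * s ≤ 2 := by
    have h1 : (j : ℝ) * s ≤ (1 / s + 1) * s := mul_le_mul_of_nonneg_right hjle hs.le
    have h2 : (1 / s + 1) * s = 1 + s := by field_simp
    rw [h2] at h1
    linarith
  refine ⟨8 * (k₁ * j), by omega, ?_, ?_, h β hβ0 hβ (k₁ * j) (Nat.le_mul_of_pos_right k₁ (by omega))⟩
  · push_cast
    nlinarith [mul_nonneg (sub_nonneg.2 hk₁') hj0]
  · rw [le_div_iff₀ hs]
    push_cast
    have h3 : 8 * ((k₁ : ℝ) * j) * s = 8 * k₁ * (j * s) := by ring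
    rw [h3]
    have h4 : (0 : ℝ) ≤ 8 * k₁ := by positivity
    nlinarith [mul_le_mul_of_nonneg_left hjs h4]

/-- **RUNG for R (TYPED, OPEN — not a stub of this line's composition): the dyadic contraction on the strong-coupling
window**, uniformly in `0 ≤ β ≤ strongCouplingRadius r.ρ` (group-blind).  Upper half in tree (`coldDefect_le_of_strongCoupling`);
the matching LOWER bound `δᶜ_β(L) ≥ c·L³·e^{−m(β)⌊L/4⌋}` (one-particle dominance of the thermal trace at strong coupling,
Osterwalder–Seiler 1978 §3 / Seiler LNP 159) is NOT in tree, so this rung is recorded, not proved. -/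
def ColdDoublingRecursionStrongCoupling : Prop :=
  ∀ (G : Type) [Group G] [TopologicalSpace G] [IsTopologicalGroup G] [CompactSpace G],
    letI : MeasurableSpace G := borel G
    haveI : BorelSpace G := ⟨rfl⟩
    ∀ r : LatticeRep G, ∃ C : ℝ, 0 < C ∧ ∃ L₀ : ℕ, ∀ β : ℝ, 0 ≤ β → β ≤ strongCouplingRadius r.ρ →
      ∀ L : ℕ, L₀ ≤ L → ∀ L' : ℕ, 2 * L ≤ L' → L' ≤ 4 * L →
        coldDefect r.ρ β L' ≤ C * coldDefect r.ρ β L ^ 2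

end Rungs

/-! ## §7 R in SPECTRAL currency (the dictionary purity defect ↔ thermal trace excess, made two-sided; PROVED reduction)

`δᶜ` and the trace excess `x_t(N) = Σ_{i ≠ 0} (λᵢ/λ₀)^t` of the torus transfer matrix at the cold time `t = ⌊L/4⌋` are the SAME
quantity up to a factor: `2x/(1+x)² ≤ δᶜ ≤ 2x` (`one_sub_ratio_ge_of_traceExcess`, `one_sub_ratio_le_two_mul_traceExcess`).  Hence
R is, past the exit, a statement about the low-lying transfer-matrix spectrum under SIMULTANEOUS doubling of the spatial torus
and of the Euclidean time: `SpectralDiagonalContractionSC` («`x_{⌊L'/4⌋}(L') ≤ C·x_{⌊L/4⌋}(L)²` whenever `x_{⌊L/4⌋}(L) ≤ x₀`»,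
i.e. `m(β, L')·L'/4 ≥ 2·m(β, L)·L/4 − log C` with multiplicities: the finite-volume mass does not drop under spatial doubling by
more than `O(1/L)`, cf. Lüscher's negative finite-size mass shift) is EQUIVALENT to R up to constants — both directions
PROVED: `coldDoublingRecursionSC_of_spectral` (the large-defect regime `δᶜ(L) > η₀` is free because `δᶜ(L') ≤ 1`) and
`spectral_of_coldDoublingRecursionSC` (`x₀ = min 1 (1/(16C))`, `C ↦ 8C`). -/

section Spectral

variable {G : Type} [Group G] [TopologicalSpace G] [IsTopologicalGroup G] [CompactSpace G]
  [MeasurableSpace G] [BorelSpace G]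

open Summit.QuantumFields.YangMills.Theorems.DoublingDefect (exists_ratios_hasSum_traceExcess)

/-- **Lower bound: the trace excess forces impurity**: `2x/(1+x)² ≤ 1 − Z(N³×2t)/Z(N³×t)²` with `x = x_t(N)`, `t = m+2`,
`β ≥ 0` — because `x_{2t} = Σ_{i≠0} rᵢ^{2t} ≤ x_t²` (each `rᵢ^t ≤ x_t`), so `Z(2t)/Z(t)² = (1+x_{2t})/(1+x_t)² ≤ (1+x²)/(1+x)²`. -/
theorem one_sub_ratio_ge_of_traceExcess (r : LatticeRep G) {β : ℝ} (hβ : 0 ≤ β) (N m : ℕ) [NeZero N] :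
    2 * traceExcess r.ρ β N (m + 2) / (1 + traceExcess r.ρ β N (m + 2)) ^ 2 ≤
      1 - wilsonFinTorusPartition r.ρ β N N N (2 * (m + 2)) / wilsonFinTorusPartition r.ρ β N N N (m + 2) ^ 2 := by
  haveI : SecondCountableTopology G :=
    (r.continuous.isClosedEmbedding r.injective).isEmbedding.secondCountableTopology
  obtain ⟨ι, _, q, i₀, hq, hqi₀, hpos, hT, hx⟩ :=
    exists_ratios_hasSum_traceExcess r.continuous r.mem_unitary hβ N
  set lp : ℝ := transferSpectralRadius r.ρ β N with hlp
  set W₁ : ℝ := wilsonFinTorusPartition r.ρ β N N N (m + 2) with hW₁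
  set W₂ : ℝ := wilsonFinTorusPartition r.ρ β N N N (2 * (m + 2)) with hW₂
  set x : ℝ := traceExcess r.ρ β N (m + 2) with hxdef
  have hW₁pos : 0 < W₁ := wilsonFinTorusPartition_pos r.continuous β N N N (m + 2)
  have hT₁ := hT m
  have hT₂ : HasSum (fun i => q i ^ (2 * m + 2 + 2)) (W₂ / lp ^ (2 * (m + 2))) := by
    have h := hT (2 * m + 2)
    rw [show 2 * m + 2 + 2 = 2 * (m + 2) from by ring] at h ⊢
    exact h
  set T₁ : ℝ := W₁ / lp ^ (m + 2) with hT₁def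
  set T₂ : ℝ := W₂ / lp ^ (2 * (m + 2)) with hT₂def
  -- `x = T₁ - 1`, `x ≥ 0`
  have hx₁ := hx m
  have hxT : x = T₁ - 1 := by
    have h' : HasSum (Function.update (fun i => q i ^ (m + 2)) i₀ 0) (0 - 1 + T₁) := by
      have := hT₁.update i₀ 0
      simpa [hqi₀] using this
    have := hx₁.unique h'
    rw [hxdef]; linarith
  have hx0 : 0 ≤ x := by
    rw [hxdef]
    refine hx₁.nonneg (fun i => ?_)
    rcases eq_or_ne i i₀ with h | h
    · simp [h]
    · simp [Function.update_of_ne h, pow_nonneg (hq i).1]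
  -- each excited ratio power is at most `x`
  have hqi : ∀ i, i ≠ i₀ → q i ^ (m + 2) ≤ x := by
    intro i hi
    have h := le_hasSum hx₁ i fun j _ => by
      rcases eq_or_ne j i₀ with h | h
      · simp [h]
      · simp [Function.update_of_ne h, pow_nonneg (hq j).1]
    simpa [Function.update_of_ne hi] using h
  -- `x₂ ≤ x²` where `1 + x₂ = T₂`
  have hx₂ := hx (2 * m + 2)
  have hx₂' : HasSum (Function.update (fun i => q i ^ (2 * m + 2 + 2)) i₀ 0) (-1 + T₂) := by
    have := hT₂.update i₀ 0
    simpa [hqi₀] using this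
  have hle : ∀ i, Function.update (fun i => q i ^ (2 * m + 2 + 2)) i₀ 0 i ≤
      x * Function.update (fun i => q i ^ (m + 2)) i₀ 0 i := by
    intro i
    rcases eq_or_ne i i₀ with h | h
    · simp [h]
    · simp only [Function.update_of_ne h]
      have hsq : q i ^ (2 * m + 2 + 2) = q i ^ (m + 2) * q i ^ (m + 2) := by
        rw [← pow_add]; congr 1; ring
      rw [hsq]
      exact mul_le_mul_of_nonneg_right (hqi i h) (pow_nonneg (hq i).1 _)
  have hT₂le : -1 + T₂ ≤ x * x := hasSum_le hle hx₂' (hx₁.mul_left x)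
  -- conclude: `1 - T₂/T₁² ≥ 1 - (1 + x²)/(1 + x)² = 2x/(1+x)²`
  have hT₁pos : 0 < T₁ := by rw [show T₁ = 1 + x from by linarith]; positivity
  have hid : W₂ / W₁ ^ 2 = T₂ / T₁ ^ 2 := by
    have h1 : lp ^ (m + 2) ≠ 0 := pow_ne_zero _ hpos.ne'
    have h2 : W₁ ≠ 0 := hW₁pos.ne'
    rw [hT₂def, hT₁def]
    field_simp
    ring
  rw [hid, show T₁ = 1 + x from by linarith]
  have h1x : 0 < (1 + x) ^ 2 := by positivity
  rw [div_le_iff₀ h1x, sub_mul, div_mul_cancel₀ _ h1x.ne']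
  nlinarith [hT₂le]

/-- **R in spectral currency (OPEN; a sufficient form of `ColdDoublingRecursionSC`).**  For compact simple SIMPLY-CONNECTED `G`
and every `r`: there are `x₀ > 0`, `C > 0`, `β₀`, `L₀` such that for `β ≥ β₀`, `L ≥ L₀`, `2L ≤ L' ≤ 4L`: if the cold trace
excess at size `L` is small, `x_{⌊L/4⌋}(L) ≤ x₀`, then `x_{⌊L'/4⌋}(L') ≤ C · x_{⌊L/4⌋}(L)²` — simultaneous doubling of space
and time squares the thermal multiplicity of the excited tower (rate per unit length retained, all slack in `C`).  Instance
binders `[NeZero L]` and the parametrisation `⌊L/4⌋ = m + 2` (so `L ≥ 8`) make the trace excess well-typed.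
[conjectural obligation; open] -/
def SpectralDiagonalContractionSC : Prop :=
  ∀ (G : Type) [Group G] [TopologicalSpace G] [IsTopologicalGroup G] [CompactSpace G],
    IsCompactSimpleLieGroup G → SimplyConnectedSpace G →
    letI : MeasurableSpace G := borel G
    haveI : BorelSpace G := ⟨rfl⟩
    ∀ r : LatticeRep G, ∃ x₀ : ℝ, 0 < x₀ ∧ ∃ C : ℝ, 0 < C ∧ ∃ β₀ : ℝ, ∃ L₀ : ℕ, ∀ β : ℝ, β₀ ≤ β →
      ∀ (L : ℕ) [NeZero L] (m : ℕ), L / 4 = m + 2 → L₀ ≤ L →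
        ∀ (L' : ℕ) [NeZero L'] (m' : ℕ), L' / 4 = m' + 2 → 2 * L ≤ L' → L' ≤ 4 * L →
          traceExcess r.ρ β L (m + 2) ≤ x₀ →
            traceExcess r.ρ β L' (m' + 2) ≤ C * traceExcess r.ρ β L (m + 2) ^ 2

/-- **Spectral contraction ⇒ R (PROVED).**  With `η₀ = min (1/4) (x₀/2)`: if `δᶜ_β(L) ≤ η₀` then `x(L) ≤ 2η₀ ≤ x₀`
(`traceExcess_le_of_coldDefect_le`), the spectral contraction gives `x(L') ≤ C x(L)²`, and `δᶜ(L') ≤ 2x(L')`,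
`x(L) ≤ ((1+x₀)²/2)·δᶜ(L)` (two-sided dictionary) give `δᶜ(L') ≤ (C(1+x₀)⁴/2)·δᶜ(L)²`; if `δᶜ_β(L) > η₀` then
`δᶜ(L') ≤ 1 ≤ η₀⁻²·δᶜ(L)²`.  So R holds with `C_R = max (C(1+x₀)⁴/2) η₀⁻²`, `β₀ ↦ max β₀ 0`, `L₀ ↦ max L₀ 8`. -/
theorem coldDoublingRecursionSC_of_spectral (hS : SpectralDiagonalContractionSC) : ColdDoublingRecursionSC := by
  intro G _ _ _ _ hG hsc
  letI : MeasurableSpace G := borel G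
  haveI : BorelSpace G := ⟨rfl⟩
  intro r
  haveI : SecondCountableTopology G :=
    (r.continuous.isClosedEmbedding r.injective).isEmbedding.secondCountableTopology
  obtain ⟨x₀, hx₀, C, hC, β₀, L₀, h⟩ := hS G hG hsc r
  set η₀ : ℝ := min (1 / 4) (x₀ / 2) with hη₀
  have hη₀pos : 0 < η₀ := lt_min (by norm_num) (by linarith)
  have hη₀le : η₀ ≤ 1 / 4 := min_le_left _ _
  have hη₀x : 2 * η₀ ≤ x₀ := by have := min_le_right (1 / 4 : ℝ) (x₀ / 2); linarith
  set CR : ℝ := max (C * (1 + x₀) ^ 4 / 2) (η₀⁻¹ ^ 2) with hCR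
  have hCRpos : 0 < CR := lt_of_lt_of_le (by positivity) (le_max_right _ _)
  refine ⟨CR, max β₀ 0, max L₀ 8, hCRpos, fun β hβ L hL L' hLL' hL'L => ?_⟩
  have hβ0 : 0 ≤ β := le_trans (le_max_right _ _) hβ
  have hββ₀ : β₀ ≤ β := le_trans (le_max_left _ _) hβ
  have hL8 : 8 ≤ L := le_trans (le_max_right _ _) hL
  have hLL₀ : L₀ ≤ L := le_trans (le_max_left _ _) hL
  haveI : NeZero L := ⟨by omega⟩
  haveI : NeZero L' := ⟨by omega⟩
  obtain ⟨m, hm⟩ : ∃ m : ℕ, L / 4 = m + 2 := ⟨L / 4 - 2, by omega⟩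
  obtain ⟨m', hm'⟩ : ∃ m' : ℕ, L' / 4 = m' + 2 := ⟨L' / 4 - 2, by omega⟩
  -- the two defects, abbreviated
  have hδL'le1 : coldDefect r.ρ β L' ≤ 1 := by
    unfold coldDefect
    have hZ := wilsonFinTorusPartition_pos r.continuous β L' L' L' (2 * (L' / 4))
    have hZ' := wilsonFinTorusPartition_pos r.continuous β L' L' L' (L' / 4)
    have : 0 ≤ wilsonFinTorusPartition r.ρ β L' L' L' (2 * (L' / 4)) /
        wilsonFinTorusPartition r.ρ β L' L' L' (L' / 4) ^ 2 := div_nonneg hZ.le (sq_nonneg _)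
    linarith
  have hδLnn : 0 ≤ coldDefect r.ρ β L := by
    unfold coldDefect; rw [hm]
    exact coldDefect_nonneg r.continuous r.mem_unitary hβ0 L (m + 2) (by omega)
  by_cases hsmall : coldDefect r.ρ β L ≤ η₀
  · -- small-defect regime: go through the spectrum
    have hxL : traceExcess r.ρ β L (m + 2) ≤ 2 * η₀ := by
      refine traceExcess_le_of_coldDefect_le r.continuous r.mem_unitary hβ0 L m (by linarith) ?_
      have : coldDefect r.ρ β L ≤ η₀ := hsmall
      unfold coldDefect at this; rw [hm] at this; exact this
    have hxL0 : 0 ≤ traceExcess r.ρ β L (m + 2) := by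
      have h1 := one_sub_ratio_ge_of_traceExcess r hβ0 L m
      have h2 := one_sub_ratio_le_two_mul_traceExcess r hβ0 L m
      -- from `2x/(1+x)^2 ≤ δ ≤ 2x`: if x < 0 then δ ≤ 2x < 0 ≤ ... use δ ≥ 0 instead
      have hδ : 0 ≤ 1 - wilsonFinTorusPartition r.ρ β L L L (2 * (m + 2)) /
          wilsonFinTorusPartition r.ρ β L L L (m + 2) ^ 2 :=
        coldDefect_nonneg r.continuous r.mem_unitary hβ0 L (m + 2) (by omega)
      nlinarith [h2, hδ]
    have hspec := h β hββ₀ L m hm hLL₀ L' m' hm' hLL' hL'L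
    have hxL' := hspec (by linarith)
    -- δ(L') ≤ 2 x(L')
    have hup := one_sub_ratio_le_two_mul_traceExcess r hβ0 L' m'
    -- x(L) ≤ ((1+x₀)^2/2) δ(L)
    have hlow := one_sub_ratio_ge_of_traceExcess r hβ0 L m
    set x : ℝ := traceExcess r.ρ β L (m + 2) with hxdef
    set δ : ℝ := 1 - wilsonFinTorusPartition r.ρ β L L L (2 * (m + 2)) /
        wilsonFinTorusPartition r.ρ β L L L (m + 2) ^ 2 with hδdef
    have hx_le_x₀ : x ≤ x₀ := by linarith
    have hxδ : x ≤ (1 + x₀) ^ 2 / 2 * δ := by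
      have h1x : 0 < (1 + x) ^ 2 := by positivity
      have hkey : 2 * x ≤ δ * (1 + x) ^ 2 := by
        have := hlow; rwa [div_le_iff₀ h1x] at this
      have hmono : (1 + x) ^ 2 ≤ (1 + x₀) ^ 2 :=
        pow_le_pow_left₀ (by linarith) (by linarith) 2
      have hδ0 : 0 ≤ δ := coldDefect_nonneg r.continuous r.mem_unitary hβ0 L (m + 2) (by omega)
      nlinarith [mul_le_mul_of_nonneg_left hmono hδ0]
    have hgoal : coldDefect r.ρ β L' ≤ C * (1 + x₀) ^ 4 / 2 * coldDefect r.ρ β L ^ 2 := by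
      have hδL : coldDefect r.ρ β L = δ := by unfold coldDefect; rw [hm]
      have hδL' : coldDefect r.ρ β L' = 1 - wilsonFinTorusPartition r.ρ β L' L' L' (2 * (m' + 2)) /
          wilsonFinTorusPartition r.ρ β L' L' L' (m' + 2) ^ 2 := by unfold coldDefect; rw [hm']
      rw [hδL, hδL']
      have hx2 : x ^ 2 ≤ ((1 + x₀) ^ 2 / 2 * δ) ^ 2 := pow_le_pow_left₀ hxL0 hxδ 2
      calc 1 - wilsonFinTorusPartition r.ρ β L' L' L' (2 * (m' + 2)) /
            wilsonFinTorusPartition r.ρ β L' L' L' (m' + 2) ^ 2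
          ≤ 2 * traceExcess r.ρ β L' (m' + 2) := hup
        _ ≤ 2 * (C * x ^ 2) := by linarith
        _ ≤ 2 * (C * ((1 + x₀) ^ 2 / 2 * δ) ^ 2) := by nlinarith [mul_le_mul_of_nonneg_left hx2 hC.le]
        _ = C * (1 + x₀) ^ 4 / 2 * δ ^ 2 := by ring
    calc coldDefect r.ρ β L' ≤ C * (1 + x₀) ^ 4 / 2 * coldDefect r.ρ β L ^ 2 := hgoal
      _ ≤ CR * coldDefect r.ρ β L ^ 2 :=
          mul_le_mul_of_nonneg_right (le_max_left _ _) (sq_nonneg _)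
  · -- large-defect regime: free
    push Not at hsmall
    have h1 : 1 ≤ η₀⁻¹ ^ 2 * coldDefect r.ρ β L ^ 2 := by
      have hη : η₀⁻¹ * coldDefect r.ρ β L ≥ 1 := by
        rw [ge_iff_le, inv_mul_eq_div, le_div_iff₀ hη₀pos]; linarith
      have : (η₀⁻¹ * coldDefect r.ρ β L) ^ 2 ≥ 1 := by nlinarith
      calc (1 : ℝ) ≤ (η₀⁻¹ * coldDefect r.ρ β L) ^ 2 := this
        _ = η₀⁻¹ ^ 2 * coldDefect r.ρ β L ^ 2 := by ring
    calc coldDefect r.ρ β L' ≤ 1 := hδL'le1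
      _ ≤ η₀⁻¹ ^ 2 * coldDefect r.ρ β L ^ 2 := h1
      _ ≤ CR * coldDefect r.ρ β L ^ 2 :=
          mul_le_mul_of_nonneg_right (le_max_right _ _) (sq_nonneg _)

/-- **R ⇒ spectral contraction (PROVED): the re-typing is an EQUIVALENCE up to constants.**  Given R with constant `C`,
take `x₀ = min 1 (1/(16C))`: if `x(L) ≤ x₀` then `δᶜ(L) ≤ 2x(L)`, so `δᶜ(L') ≤ C·δᶜ(L)² ≤ 4C·x(L)² ≤ 1/4`, whence
`x(L') ≤ 2δᶜ(L') ≤ 8C·x(L)²`. -/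
theorem spectral_of_coldDoublingRecursionSC (hR : ColdDoublingRecursionSC) : SpectralDiagonalContractionSC := by
  intro G _ _ _ _ hG hsc
  letI : MeasurableSpace G := borel G
  haveI : BorelSpace G := ⟨rfl⟩
  intro r
  haveI : SecondCountableTopology G :=
    (r.continuous.isClosedEmbedding r.injective).isEmbedding.secondCountableTopology
  obtain ⟨C, β₀, L₀, hC, h⟩ := hR G hG hsc r
  set x₀ : ℝ := min 1 (1 / (16 * C)) with hx₀
  have hx₀pos : 0 < x₀ := lt_min one_pos (by positivity)
  have hx₀1 : x₀ ≤ 1 := min_le_left _ _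
  have hx₀C : x₀ ≤ 1 / (16 * C) := min_le_right _ _
  refine ⟨x₀, hx₀pos, 8 * C, by positivity, max β₀ 0, max L₀ 8, ?_⟩
  intro β hβ L _ m hm hL L' _ m' hm' hLL' hL'L hx
  have hβ0 : 0 ≤ β := le_trans (le_max_right _ _) hβ
  have hββ₀ : β₀ ≤ β := le_trans (le_max_left _ _) hβ
  have hLL₀ : L₀ ≤ L := le_trans (le_max_left _ _) hL
  set x : ℝ := traceExcess r.ρ β L (m + 2) with hxdef
  -- `δ(L) ≤ 2x`, `x ≥ 0`
  have hup := one_sub_ratio_le_two_mul_traceExcess r hβ0 L m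
  have hδ0 : 0 ≤ 1 - wilsonFinTorusPartition r.ρ β L L L (2 * (m + 2)) /
      wilsonFinTorusPartition r.ρ β L L L (m + 2) ^ 2 :=
    coldDefect_nonneg r.continuous r.mem_unitary hβ0 L (m + 2) (by omega)
  have hxnn : 0 ≤ x := by nlinarith [hup, hδ0]
  have hδL : coldDefect r.ρ β L = 1 - wilsonFinTorusPartition r.ρ β L L L (2 * (m + 2)) /
      wilsonFinTorusPartition r.ρ β L L L (m + 2) ^ 2 := by unfold coldDefect; rw [hm]
  have hδL' : coldDefect r.ρ β L' = 1 - wilsonFinTorusPartition r.ρ β L' L' L' (2 * (m' + 2)) /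
      wilsonFinTorusPartition r.ρ β L' L' L' (m' + 2) ^ 2 := by unfold coldDefect; rw [hm']
  have hRβ := h β hββ₀ L hLL₀ L' hLL' hL'L
  -- `δ(L') ≤ C δ(L)² ≤ 4 C x²`
  have hδLle : coldDefect r.ρ β L ≤ 2 * x := by rw [hδL]; exact hup
  have hδLnn : 0 ≤ coldDefect r.ρ β L := by rw [hδL]; exact hδ0
  have hsq : coldDefect r.ρ β L ^ 2 ≤ (2 * x) ^ 2 := pow_le_pow_left₀ hδLnn hδLle 2
  have hδL'le : coldDefect r.ρ β L' ≤ 4 * C * x ^ 2 := by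
    calc coldDefect r.ρ β L' ≤ C * coldDefect r.ρ β L ^ 2 := hRβ
      _ ≤ C * (2 * x) ^ 2 := mul_le_mul_of_nonneg_left hsq hC.le
      _ = 4 * C * x ^ 2 := by ring
  -- `4 C x² ≤ 1/4` since `x ≤ x₀ ≤ min 1 (1/(16C))`
  have hx2 : x ^ 2 ≤ x₀ * (1 / (16 * C)) := by
    have h1 : x ^ 2 ≤ x₀ ^ 2 := pow_le_pow_left₀ hxnn hx 2
    have h2 : x₀ ^ 2 ≤ x₀ * (1 / (16 * C)) := by
      rw [sq]; exact mul_le_mul_of_nonneg_left hx₀C hx₀pos.le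
    exact h1.trans h2
  have hquarter : coldDefect r.ρ β L' ≤ 1 / 4 := by
    have : 4 * C * x ^ 2 ≤ 4 * C * (x₀ * (1 / (16 * C))) := mul_le_mul_of_nonneg_left hx2 (by positivity)
    have h' : 4 * C * (x₀ * (1 / (16 * C))) = x₀ / 4 := by field_simp; ring
    linarith
  -- `x(L') ≤ 2 δ(L')`
  have hxL' : traceExcess r.ρ β L' (m' + 2) ≤ 2 * coldDefect r.ρ β L' := by
    refine traceExcess_le_of_coldDefect_le r.continuous r.mem_unitary hβ0 L' m' (by linarith) ?_
    rw [← hδL']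
  calc traceExcess r.ρ β L' (m' + 2) ≤ 2 * coldDefect r.ρ β L' := hxL'
    _ ≤ 2 * (4 * C * x ^ 2) := by linarith
    _ = 8 * C * x ^ 2 := by ring

end Spectral

end Summit.QuantumFields.YangMills.Cruxes.IR.DoublingBridge

end
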